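import Summits.BirchSwinnertonDyer.BirchSwinnertonDyer.Theorems.ThetaPartnerAtTwoSignedKatoUpToAtTwoOffTwoRobust
import HarnessLib

/-!
# Route `ThetaPartnerAtTwo` (TP2), crux K3 `SignedKatoDivisibilityUpToAtTwo` (item stmt-BirchSwinnertonDyer-20308),
# line `colemanrat` v3: **`Δ = {±1}`-DESCENT OFF `2`** — for a module with an involution, invariants, coinvariants,
# the norm map and the `±`-decomposition all agree IN LOCAL LENGTH at every prime not containing `2`
# (width seat `bsd-wall-tp2-p2x-w3`; route-independent commutative algebra, any commutative ring)

HONEST FRAMING (cell `bsd-wall`): THEOREMS ONLY — no definition, no named fact, no instance, no `sorry`; pure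
commutative algebra; nothing about any curve or Selmer group is asserted; closes no item; BSD is NOT proved by any
of this.

## Why this file

At `p = 2` every object of Kato §§12–13 and Kobayashi §§6–8 is born over `K_∞ = ℚ(μ_{2^∞})` as a module over
`Λ_K = ℤ₂[[G_∞]] = Λ[Δ]`, `Δ = Gal(K_∞/ℚ_∞) = {1, c}` of order `2 = p` (Kato §12.1: at `p = 2`, `ℤ₂^× = {±1} ×
(1 + 4ℤ₂)` and `Λ_K` is NOT a product of copies of `Λ`; Sprung 2012 p. 1487: `k_n = ℚ₂(ζ_{2^{n+2}})`). The crux K3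
lives on the `Δ`-trivial component (`ℚ_∞`), and the reading flag `Kato-134-two-Delta` of
`Kato2004/EulerSystemBoundFineSelmerTwo.lean` argues IN PROSE that at a height-one prime `𝔭 ∌ 2` of `Λ` the passage
`M ↦ M^Δ`, `M ↦ M_Δ` is harmless (`2 ∈ Λ_𝔭ˣ`). This file is that argument IN THE KERNEL, for an arbitrary
`R`-module `M` with an `R`-linear involution `τ`:
* `two_smul_eq_zero_of_mem_invariants_of_mem_range` — `ker(τ − 1) ∩ range(τ − 1)` is killed by `2`;
* `two_smul_mkQ_eq_mkQ_add_map` — the cokernel of `M^τ → M_τ` is killed by `2`;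
* `lengthAt_invariants_eq_lengthAt_coinvariants` — `ℓ_𝔭(M^τ) = ℓ_𝔭(M_τ)` for `2 ∉ 𝔭`;
* `lengthAt_invariants_quotient_norm_eq_zero` — `ℓ_𝔭(M^τ / (1 + τ)M) = 0` for `2 ∉ 𝔭` (Tate cohomology `Ĥ⁰(Δ, M)`
  is `2`-torsion);
* `lengthAt_eq_lengthAt_invariants_add_lengthAt_antiInvariants` — `ℓ_𝔭(M) = ℓ_𝔭(M^{τ=1}) + ℓ_𝔭(M^{τ=−1})` for
  `2 ∉ 𝔭` (`Λ_K ⊗ Λ_𝔭 = Λ_𝔭 e₊ × Λ_𝔭 e₋`).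
These are the inputs with which a `K_∞`-level statement of the `2`-adic Coleman–Poitou–Tate package (typed verbatim
from the print, with its `Δ`-action) descends to the `2`-ROBUST `ℚ_∞`-level package of `…OffTwoRobust`
(`signedKatoDivisibilityUpToAtTwo_of_robustZetaSpanPackageTwo_of_pub`: every clause up to `2^m`).
§2: `lengthAt_le_of_smul_mem_range`, `lengthAt_eq_of_smul_ker_eq_zero_of_smul_mem_range` — a map with kernel and
cokernel killed by `u ∉ 𝔭` preserves `ℓ_𝔭`. §3: `signedKatoDivisibilityUpToAtTwo_of_comparedRobustPackageTwo_of_pub`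
— K3 BY NAME modulo print from a `2`-robust package stated on the prover's OWN models `X', Y'` of the signed / fine
Selmer duals (e.g. `Δ`-parts of the `K_∞`-objects), COMPARED to the pinned `D.X`, `Y.X` by maps with `2^m`-torsion
kernels: the Selmer side of the package is decoupled from the pinned data structures.

References: [Kato2004Asterisque] §12.1 (p. 219), Thm. 13.4 (p. 226), §13.8 (p. 228); [Sprung2012] p. 1487;
[Kobayashi2003] Thm. 6.2 (6.13)–(6.14) (p. 11) (the `Δ`-invariants of the Coleman map); [Washington1997] §13.1;
[Bourbaki1989CommAlg] Ch. II §2.4.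
-/

set_option autoImplicit false
-- the Theorems namespace of this sub repeats the summit name by design (D-0017 nested layout)
set_option linter.dupNamespace false

noncomputable section

open scoped Classical MatrixGroups ModularForm NumberField

open CongruenceSubgroup WeierstrassCurve Field IsDedekindDomain
  Literature.NumberTheory.GaloisRepresentations
  Literature.NumberTheory.EllipticCurves Literature.NumberTheory.EllipticCurves.ModularForms
  Literature.NumberTheory.EllipticCurves.Module Literature.NumberTheory.EllipticCurves.Rank1Residual
  Literature.NumberTheory.EllipticCurves.Kobayashi2003 Literature.NumberTheory.EllipticCurves.Kato2004
  Literature.NumberTheory.EllipticCurves.Kato2004.EulerSystemValues ZpExtension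
  Summit.BirchSwinnertonDyer.Rank1Residual.Supersingular
  Summit.BirchSwinnertonDyer.BirchSwinnertonDyer.Theses.ThetaPartnerAtTwo

namespace Summit.BirchSwinnertonDyer.BirchSwinnertonDyer.Theorems

namespace SignedKatoOffTwo

section Delta

variable {R : Type*} [CommRing R] {M : Type*} [AddCommGroup M] [_root_.Module R M]

/-- For an involution `τ` (`τ² = 1`): an element that is both `τ`-invariant and of the form `τ y − y` is killed
by `2` (`τ x = x` and `τ x = −x`). [folklore] -/
theorem two_smul_eq_zero_of_mem_invariants_of_mem_range (τ : M →ₗ[R] M) (hτ : ∀ x, τ (τ x) = x) {x : M}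
    (hinv : x ∈ LinearMap.ker (τ - LinearMap.id)) (hrange : x ∈ LinearMap.range (τ - LinearMap.id)) :
    (2 : R) • x = 0 := by
  rw [LinearMap.mem_ker, LinearMap.sub_apply, LinearMap.id_apply, sub_eq_zero] at hinv
  obtain ⟨y, rfl⟩ := hrange
  rw [LinearMap.sub_apply, LinearMap.id_apply] at hinv ⊢
  have h1 : τ (τ y - y) = -(τ y - y) := by rw [map_sub, hτ, neg_sub]
  rw [h1] at hinv
  -- `-x = x` ⇒ `2 • x = 0`
  rw [two_smul]
  nth_rw 1 [← hinv]
  exact neg_add_cancel _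

/-- For an involution `τ`: `m + τ m` is `τ`-invariant. [folklore] -/
theorem add_map_mem_invariants (τ : M →ₗ[R] M) (hτ : ∀ x, τ (τ x) = x) (m : M) :
    m + τ m ∈ LinearMap.ker (τ - LinearMap.id) := by
  rw [LinearMap.mem_ker, LinearMap.sub_apply, LinearMap.id_apply, map_add, hτ, sub_eq_zero, add_comm]

/-- For an involution `τ`: `2 m ≡ m + τ m` modulo `(τ − 1)M`, so the cokernel of `M^τ → M_τ = M/(τ − 1)M` is killed
by `2`. [folklore] -/
theorem two_smul_mkQ_eq_mkQ_add_map (τ : M →ₗ[R] M) (m : M) :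
    (2 : R) • (LinearMap.range (τ - LinearMap.id)).mkQ m =
      (LinearMap.range (τ - LinearMap.id)).mkQ (m + τ m) := by
  rw [← map_smul, Submodule.mkQ_apply, Submodule.mkQ_apply, Submodule.Quotient.eq, two_smul]
  refine ⟨-m, ?_⟩
  rw [LinearMap.sub_apply, LinearMap.id_apply, map_neg]
  abel

/-- **Invariants and coinvariants of an involution have the same local length off `2`.** For an `R`-linear
involution `τ` of `M` and a prime `𝔭 ∌ 2`: `ℓ_𝔭(ker(τ − 1)) = ℓ_𝔭(M / range(τ − 1))` — the natural map
`M^τ → M_τ` has kernel `M^τ ∩ (τ − 1)M` and cokernel both killed by `2`, a unit of `R_𝔭`. At `p = 2` this is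
`(M^Δ)_𝔭 = (M_Δ)_𝔭` for `Λ[Δ]`-modules, `Δ = {±1}`, at the height-one primes `𝔭 ∌ 2` (reading flag
`Kato-134-two-Delta`). [cite: Kato2004Asterisque, §12.1 (p. 219) and §13.8 (p. 228)] [cite: Bourbaki1989CommAlg, Ch. II §2.4] -/
theorem lengthAt_invariants_eq_lengthAt_coinvariants (τ : M →ₗ[R] M) (hτ : ∀ x, τ (τ x) = x)
    (𝔭 : PrimeSpectrum R) (h2 : (2 : R) ∉ 𝔭.asIdeal) :
    lengthAt R (LinearMap.ker (τ - LinearMap.id)) 𝔭 =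
      lengthAt R (M ⧸ LinearMap.range (τ - LinearMap.id)) 𝔭 := by
  set V : Submodule R M := LinearMap.ker (τ - LinearMap.id)
  set B : Submodule R M := LinearMap.range (τ - LinearMap.id)
  let φ : V →ₗ[R] M ⧸ B := B.mkQ ∘ₗ V.subtype
  refine le_antisymm ?_ ?_
  · -- kernel of `φ` killed by `2`
    refine lengthAt_le_of_smul_ker_eq_zero φ 𝔭 h2 fun x hx ↦ ?_
    have hxB : (x : M) ∈ B := by
      rw [LinearMap.comp_apply, Submodule.subtype_apply, Submodule.mkQ_apply,
        Submodule.Quotient.mk_eq_zero] at hx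
      exact hx
    exact Subtype.ext (two_smul_eq_zero_of_mem_invariants_of_mem_range τ hτ x.2 hxB)
  · -- cokernel of `φ` killed by `2`
    have h1 : lengthAt R (M ⧸ B) 𝔭 =
        lengthAt R (LinearMap.range φ) 𝔭 + lengthAt R ((M ⧸ B) ⧸ LinearMap.range φ) 𝔭 :=
      lengthAt_eq_add_quotient _ 𝔭
    have h2' : lengthAt R ((M ⧸ B) ⧸ LinearMap.range φ) 𝔭 = 0 := by
      refine lengthAt_eq_zero_of_smul_eq_zero 𝔭 h2 fun q ↦ ?_
      induction q using Submodule.Quotient.induction_on with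
      | H y =>
        induction y using Submodule.Quotient.induction_on with
        | H m =>
          rw [← Submodule.Quotient.mk_smul, Submodule.Quotient.mk_eq_zero]
          refine ⟨⟨m + τ m, add_map_mem_invariants τ hτ m⟩, ?_⟩
          rw [LinearMap.comp_apply, Submodule.subtype_apply, ← Submodule.mkQ_apply,
            two_smul_mkQ_eq_mkQ_add_map τ m]
    have h3 : lengthAt R (LinearMap.range φ) 𝔭 ≤ lengthAt R V 𝔭 :=
      lengthAt_le_of_surjective φ.rangeRestrict φ.surjective_rangeRestrict 𝔭
    rw [h1, h2', add_zero]
    exact h3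

/-- For an endomorphism `τ` (an involution in the application): `M^τ/(M^τ ∩ (1 + τ)M)` is killed by `2`
(`2 x = (1 + τ) x` for `x` invariant) — Tate cohomology `Ĥ⁰(Δ, M)` is `2`-torsion; hence `ℓ_𝔭(M^τ/(1+τ)M) = 0`
for `2 ∉ 𝔭` (restriction ∘ corestriction `= 2` along `K_n = ℚ_n(i)`). [cite: Kato2004Asterisque, §13.8 (p. 228)]
[cite: Washington1997, §13.1] -/
theorem lengthAt_invariants_quotient_norm_eq_zero (τ : M →ₗ[R] M)
    (𝔭 : PrimeSpectrum R) (h2 : (2 : R) ∉ 𝔭.asIdeal) :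
    lengthAt R ((LinearMap.ker (τ - LinearMap.id)) ⧸
      Submodule.comap (LinearMap.ker (τ - LinearMap.id)).subtype (LinearMap.range (τ + LinearMap.id))) 𝔭 = 0 := by
  refine lengthAt_eq_zero_of_smul_eq_zero 𝔭 h2 fun q ↦ ?_
  induction q using Submodule.Quotient.induction_on with
  | H x =>
    rw [← Submodule.Quotient.mk_smul, Submodule.Quotient.mk_eq_zero, Submodule.mem_comap,
      Submodule.subtype_apply, Submodule.coe_smul]
    have hx : τ (x : M) = x := by
      have h := x.2
      rw [LinearMap.mem_ker, LinearMap.sub_apply, LinearMap.id_apply, sub_eq_zero] at h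
      exact h
    refine ⟨(x : M), ?_⟩
    rw [LinearMap.add_apply, LinearMap.id_apply, hx, two_smul]

/-- **`±`-decomposition off `2`.** For an involution `τ` and a prime `𝔭 ∌ 2`:
`ℓ_𝔭(M) = ℓ_𝔭(ker(τ − 1)) + ℓ_𝔭(ker(τ + 1))` — the sum map `M⁺ × M⁻ → M` has kernel (`a = −b`, `τ a = a`,
`τ b = −b` ⇒ `2a = 0`) and cokernel (`2m = (m + τm) + (m − τm)`) killed by `2`. At `p = 2`:
`Λ_K ⊗_Λ Λ_𝔭 = Λ_𝔭 e₊ × Λ_𝔭 e₋` for `Λ_K = Λ[Δ]`, so a `Λ_K`-module localised at a height-one `𝔭 ∌ 2` splits into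
its `Δ = ±1` parts (flag `Kato-134-two-Delta`: `M_{𝔔_±} = (M^{Δ = ±1})_𝔭`).
[cite: Kato2004Asterisque, §12.1 (12.1.2) (p. 219) and Thm. 13.4 (p. 226)] [cite: Bourbaki1989CommAlg, Ch. II §2.4] -/
theorem lengthAt_eq_lengthAt_invariants_add_lengthAt_antiInvariants (τ : M →ₗ[R] M) (hτ : ∀ x, τ (τ x) = x)
    (𝔭 : PrimeSpectrum R) (h2 : (2 : R) ∉ 𝔭.asIdeal) :
    lengthAt R M 𝔭 =
      lengthAt R (LinearMap.ker (τ - LinearMap.id)) 𝔭 + lengthAt R (LinearMap.ker (τ + LinearMap.id)) 𝔭 := by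
  set Vp : Submodule R M := LinearMap.ker (τ - LinearMap.id)
  set Vm : Submodule R M := LinearMap.ker (τ + LinearMap.id)
  -- the sum map `Vp × Vm → M`
  let σ : (Vp × Vm) →ₗ[R] M := Vp.subtype ∘ₗ LinearMap.fst R Vp Vm + Vm.subtype ∘ₗ LinearMap.snd R Vp Vm
  have hσ : ∀ ab : Vp × Vm, σ ab = (ab.1 : M) + (ab.2 : M) := fun ab ↦ rfl
  rw [← lengthAt_prod R Vp Vm 𝔭]
  refine le_antisymm ?_ ?_
  · -- cokernel of `σ` killed by `2`
    have h1 : lengthAt R M 𝔭 =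
        lengthAt R (LinearMap.range σ) 𝔭 + lengthAt R (M ⧸ LinearMap.range σ) 𝔭 :=
      lengthAt_eq_add_quotient _ 𝔭
    have h0 : lengthAt R (M ⧸ LinearMap.range σ) 𝔭 = 0 := by
      refine lengthAt_eq_zero_of_smul_eq_zero 𝔭 h2 fun q ↦ ?_
      induction q using Submodule.Quotient.induction_on with
      | H m =>
        rw [← Submodule.Quotient.mk_smul, Submodule.Quotient.mk_eq_zero]
        have hp : m + τ m ∈ Vp := add_map_mem_invariants τ hτ m
        have hm : m - τ m ∈ Vm := by
          rw [LinearMap.mem_ker, LinearMap.add_apply, LinearMap.id_apply, map_sub, hτ]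
          abel
        refine ⟨(⟨m + τ m, hp⟩, ⟨m - τ m, hm⟩), ?_⟩
        rw [hσ, two_smul]
        change (m + τ m) + (m - τ m) = m + m
        abel
    rw [h1, h0, add_zero]
    exact lengthAt_le_of_surjective σ.rangeRestrict σ.surjective_rangeRestrict 𝔭
  · -- kernel of `σ` killed by `2`
    refine lengthAt_le_of_smul_ker_eq_zero σ 𝔭 h2 fun ab hab ↦ ?_
    obtain ⟨⟨a, ha⟩, ⟨b, hb⟩⟩ := ab
    rw [hσ] at hab
    change a + b = 0 at hab
    have ha' : τ a = a := by
      rw [LinearMap.mem_ker, LinearMap.sub_apply, LinearMap.id_apply, sub_eq_zero] at ha; exact ha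
    have hb' : τ b = -b := by
      rw [LinearMap.mem_ker, LinearMap.add_apply, LinearMap.id_apply, add_eq_zero_iff_eq_neg] at hb; exact hb
    have hba : b = -a := eq_neg_of_add_eq_zero_right hab
    have h2a : (2 : R) • a = 0 := by
      have h : a = -a := by
        calc a = τ a := ha'.symm
          _ = τ (-b) := by rw [hba, neg_neg]
          _ = b := by rw [map_neg, hb', neg_neg]
          _ = -a := hba
      rw [two_smul]
      nth_rw 2 [h]
      exact add_neg_cancel a
    have h2b : (2 : R) • b = 0 := by rw [hba, smul_neg, h2a, neg_zero]
    refine Prod.ext (Subtype.ext ?_) (Subtype.ext ?_)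
    · exact h2a
    · exact h2b

end Delta

/-! ## §2 Comparison maps whose kernel and cokernel are killed by `u ∉ 𝔭` preserve `ℓ_𝔭` -/

section Compare

variable {R : Type*} [CommRing R] {M N : Type*} [AddCommGroup M] [_root_.Module R M]
  [AddCommGroup N] [_root_.Module R N]

/-- If the COKERNEL of `f : M → N` is killed by `u ∉ 𝔭` (`u · N ⊆ range f`), then `ℓ_𝔭(N) ≤ ℓ_𝔭(M)`.
[cite: Bourbaki1989CommAlg, Ch. II §2.4] -/
theorem lengthAt_le_of_smul_mem_range (f : M →ₗ[R] N) {u : R} (𝔭 : PrimeSpectrum R) (hu : u ∉ 𝔭.asIdeal)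
    (h : ∀ y, u • y ∈ LinearMap.range f) : lengthAt R N 𝔭 ≤ lengthAt R M 𝔭 := by
  have h1 : lengthAt R N 𝔭 =
      lengthAt R (LinearMap.range f) 𝔭 + lengthAt R (N ⧸ LinearMap.range f) 𝔭 :=
    lengthAt_eq_add_quotient _ 𝔭
  have h0 : lengthAt R (N ⧸ LinearMap.range f) 𝔭 = 0 := by
    refine lengthAt_eq_zero_of_smul_eq_zero 𝔭 hu fun q ↦ ?_
    induction q using Submodule.Quotient.induction_on with
    | H y => rw [← Submodule.Quotient.mk_smul, Submodule.Quotient.mk_eq_zero]; exact h y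
  rw [h1, h0, add_zero]
  exact lengthAt_le_of_surjective f.rangeRestrict f.surjective_rangeRestrict 𝔭

/-- **A map with kernel and cokernel killed by `u ∉ 𝔭` preserves `ℓ_𝔭`** (a pseudo-isomorphism «up to `u`»;
at `p = 2` with `u = 2^m`: the restriction / corestriction comparisons along `K_n = ℚ_n(i)`, whose defects are
`2`-torsion). [cite: Kato2004Asterisque, §13.8 (p. 228)] [cite: Bourbaki1989CommAlg, Ch. II §2.4] -/
theorem lengthAt_eq_of_smul_ker_eq_zero_of_smul_mem_range (f : M →ₗ[R] N) {u : R} (𝔭 : PrimeSpectrum R)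
    (hu : u ∉ 𝔭.asIdeal) (hker : ∀ x, f x = 0 → u • x = 0) (hcoker : ∀ y, u • y ∈ LinearMap.range f) :
    lengthAt R M 𝔭 = lengthAt R N 𝔭 :=
  le_antisymm (lengthAt_le_of_smul_ker_eq_zero f 𝔭 hu hker) (lengthAt_le_of_smul_mem_range f 𝔭 hu hcoker)

end Compare

/-! ## §3 K3 BY NAME, modulo print, from a `2`-robust package ON THE PROVER'S OWN MODELS of `X⁺`, `X₀`, compared
to the pinned dual data up to `2^m` (the Selmer side decoupled from `SignedSelmerDualData` / `FineSelmerDualData`) -/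

section AtTwo

/-- **K3 `SignedKatoDivisibilityUpToAtTwo` BY NAME, MODULO PRINT, from a `2`-robust package on ARBITRARY models
`X', Y'` of the signed and fine Selmer duals, COMPARED to the pinned data up to `2^m`.** Granted `h134` and `h17`,
K3 follows if for every habitat datum, dual datum `D` (torsion) and height-one `𝔭 ∌ 2` there are pinned `I`, `Y`,
abstract `Λ`-modules `P, X', Y'` (e.g. the `Δ`-invariants or `Δ`-coinvariants of `(E⁺(k_∞) ⊗ ℚ₂/ℤ₂)^∨`,
`X⁺(E/K_∞)`, `X₀(E/K_∞)`, `K_∞ = ℚ(μ_{2^∞})` — §1 says the choice does not matter at `𝔭`), `Λ`-linear `ι : P → Λ`,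
`col : 𝐇¹ → P`, `j : P → X'`, `k : X' → Y'` with `ker ι` killed by `2^m`, reciprocity `2^m · j ∘ col = 0`, cover
`2^m · ker k ⊆ range j`, COMPARISON maps `a : X⁺ = D.X → X'` and `b : Y' → X₀ = Y.X` with kernels killed by `2^m`
(restriction `Sel(ℚ_∞) → Sel(K_∞)^Δ` and its dual: Hochschild–Serre with `|Δ| = 2`), and a genuine `2`-adic
Euler-system class `s` with `ℓ_𝔭(Λ/(ι col s)) ≤ ℓ_𝔭(Λ/(L♭))`. Proof: `ℓ_𝔭(D.X) ≤ ℓ_𝔭(X')`, the robust four-term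
inequality `fourTerm_lengthAt_le_upTo` on `(𝐇¹, P, X', Y')`, `ℓ_𝔭(Y') ≤ ℓ_𝔭(Y.X)`; then as in
`signedKatoDivisibilityUpToAtTwo_of_robustPackageTwo_of_pub`. [cite: Kobayashi2003, Thm. 6.2–6.3 (p. 11), (7.17)–(7.21), Thm. 7.3 (pp. 12–13)]
[cite: Kato2004Asterisque, §12.1 (p. 219), Thm. 13.4 (2) (p. 226), §13.8 (p. 228), §17.13 (p. 279)] [cite: Sprung2012, p. 1487, Def. 6.1 (p. 1495)]
[cite: Darmon2004, Thm. 3.22] -/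
theorem signedKatoDivisibilityUpToAtTwo_of_comparedRobustPackageTwo_of_pub
    (h134 : Kato2004.thm13_4_two_lengthAt_fineSelmerDual_le_of_isEulerSystemClassTwo)
    (h17 : rank_eq_analyticRank_of_analyticRank_le_one)
    (hR : ∀ (W : WeierstrassCurve ℚ) [W.IsElliptic] [W.IsGloballyMinimal],
      ¬ W.HasCM → W.analyticRank = 0 → GoodSS W 2 → W.frobeniusTrace 2 = 0 →
      ∀ (κ : ZpExtension ℚ 2) (γ : Field.absoluteGaloisGroup ℚ) (hκ : κ.IsCyclotomic),
        κ.IsTopGenerator γ → IsCyclotomicVariable 2 γ →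
        ∀ [NeZero (W.conductorNorm ℤ)] (f : CuspForm (Gamma0 (W.conductorNorm ℤ)) 2),
          IsNewformOf W f → ∀ (ϖ : ℚ), (ϖ : ℝ) * W.realPeriodRat = plusPeriod f →
        ∀ (Lplus Lminus : IwasawaAlgebra 2), IsPollackPair f 2 Lplus Lminus →
        ∀ (D : SignedSelmerDualData W κ γ 1) [ContinuousSMul ℤ_[2] (W.tateModule 2)]
          [Module.Free ℤ_[2] (W.tateModule 2)] [Module.Finite ℤ_[2] (W.tateModule 2)],
          Module.IsTorsion (IwasawaAlgebra 2) D.X →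
          ∀ 𝔭 : PrimeSpectrum (IwasawaAlgebra 2), 𝔭.asIdeal.height = 1 →
            PowerSeries.C (2 : ℤ_[2]) ∉ 𝔭.asIdeal →
          ∃ (I : Kato2004.IwasawaH1Data W 2 κ γ) (Y : W.FineSelmerDualData κ γ)
            (P : Type) (_ : AddCommGroup P) (_ : _root_.Module (IwasawaAlgebra 2) P)
            (X' : Type) (_ : AddCommGroup X') (_ : _root_.Module (IwasawaAlgebra 2) X')
            (Y' : Type) (_ : AddCommGroup Y') (_ : _root_.Module (IwasawaAlgebra 2) Y')
            (ι : P →ₗ[IwasawaAlgebra 2] IwasawaAlgebra 2) (col : I.H →ₗ[IwasawaAlgebra 2] P)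
            (j : P →ₗ[IwasawaAlgebra 2] X') (k : X' →ₗ[IwasawaAlgebra 2] Y')
            (a : D.X →ₗ[IwasawaAlgebra 2] X') (b : Y' →ₗ[IwasawaAlgebra 2] Y.X) (s : I.H) (m : ℕ),
            (∀ y, ι y = 0 → (PowerSeries.C (2 : ℤ_[2]) : IwasawaAlgebra 2) ^ m • y = 0) ∧
            (∀ x, (PowerSeries.C (2 : ℤ_[2]) : IwasawaAlgebra 2) ^ m • j (col x) = 0) ∧
            (∀ x, k x = 0 → (PowerSeries.C (2 : ℤ_[2]) : IwasawaAlgebra 2) ^ m • x ∈ LinearMap.range j) ∧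
            (∀ x, a x = 0 → (PowerSeries.C (2 : ℤ_[2]) : IwasawaAlgebra 2) ^ m • x = 0) ∧
            (∀ y, b y = 0 → (PowerSeries.C (2 : ℤ_[2]) : IwasawaAlgebra 2) ^ m • y = 0) ∧
            Kato2004.IsEulerSystemClassTwo W hκ I s ∧
            lengthAt (IwasawaAlgebra 2) (IwasawaAlgebra 2 ⧸ Ideal.span {ι (col s)}) 𝔭 ≤
              lengthAt (IwasawaAlgebra 2) (IwasawaAlgebra 2 ⧸ Ideal.span {kobayashiL 1 Lplus Lminus}) 𝔭) :
    SignedKatoDivisibilityUpToAtTwo := by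
  refine signedKatoDivisibilityUpToAtTwo_of_offTwo
    (offTwo_of_colemanLengthTwo_of_katoBoundTwo
      (fun W _ _ hcm hr hss ha κ γ hκ hγ hcv _ f hf ϖ hϖ Lplus Lminus hPP D _ _ _ hX 𝔭 h𝔭 hp𝔭 ↦ ?_)
      (stub_katoBoundTwo_of_thm13_4_two h134))
  obtain ⟨I, Y, P, _, _, X', _, _, Y', _, _, ι, col, j, k, a, b, s, m, hι, hcj, hjk, ha', hb', hES, hdiv⟩ :=
    hR W hcm hr hss ha κ γ hκ hγ hcv f hf ϖ hϖ Lplus Lminus hPP D hX 𝔭 h𝔭 hp𝔭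
  have hL : kobayashiL 1 Lplus Lminus ≠ 0 := by rw [kobayashiL, if_pos rfl]; exact hPP.2.1
  have hcs : ι (col s) ≠ 0 := ne_zero_of_lengthAt_quotient_span_le hL 𝔭 h𝔭 hdiv
  have hs0 : s ≠ 0 := by
    rintro rfl
    exact hcs (by rw [map_zero, map_zero])
  have hinj := injective_col_of_gzk' h17 hr hκ hγ I ι col hcs
  have hu : (PowerSeries.C (2 : ℤ_[2]) : IwasawaAlgebra 2) ^ m ∉ 𝔭.asIdeal := pow_not_mem_of_not_mem 𝔭 hp𝔭 m
  have h4 := fourTerm_lengthAt_le_upTo ι col j k 𝔭 hu hι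
    (fun x hx ↦ by rw [hinj (hx.trans (map_zero col).symm), smul_zero]) hcj hjk s
  have hXa : lengthAt (IwasawaAlgebra 2) D.X 𝔭 ≤ lengthAt (IwasawaAlgebra 2) X' 𝔭 :=
    lengthAt_le_of_smul_ker_eq_zero a 𝔭 hu ha'
  have hYb : lengthAt (IwasawaAlgebra 2) Y' 𝔭 ≤ lengthAt (IwasawaAlgebra 2) Y.X 𝔭 :=
    lengthAt_le_of_smul_ker_eq_zero b 𝔭 hu hb'
  refine ⟨I, Y, s, (Kato2004.isEulerSystemClassTwo_iff W hκ I s).mp hES, hs0,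
    lengthAt_quotient_span_ne_top_of_gzk h17 hr hκ hγ I hs0 𝔭 (le_of_eq h𝔭), ?_⟩
  calc lengthAt (IwasawaAlgebra 2) D.X 𝔭 +
        lengthAt (IwasawaAlgebra 2) (I.H ⧸ Submodule.span (IwasawaAlgebra 2) {s}) 𝔭
      ≤ lengthAt (IwasawaAlgebra 2) X' 𝔭 +
          lengthAt (IwasawaAlgebra 2) (I.H ⧸ Submodule.span (IwasawaAlgebra 2) {s}) 𝔭 := add_le_add hXa le_rfl
    _ ≤ lengthAt (IwasawaAlgebra 2) Y' 𝔭 +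
          lengthAt (IwasawaAlgebra 2) (IwasawaAlgebra 2 ⧸ Ideal.span {ι (col s)}) 𝔭 := h4
    _ ≤ lengthAt (IwasawaAlgebra 2) Y.X 𝔭 +
          lengthAt (IwasawaAlgebra 2) (IwasawaAlgebra 2 ⧸ Ideal.span {kobayashiL 1 Lplus Lminus}) 𝔭 :=
        add_le_add hYb hdiv

end AtTwo

end SignedKatoOffTwo

end Summit.BirchSwinnertonDyer.BirchSwinnertonDyer.Theorems

end
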